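import Mathlib
import HarnessLib
import Summits.Ventures.LatticeQCDFlow.Scoring.ReversibleEvenLagRatios
import Summits.Ventures.LatticeQCDFlow.Scoring.GreenKuboDegenerateReversible
import Summits.Ventures.LatticeQCDFlow.Scoring.DoeblinPowerGeometricEnvelope

/-!
# The RATE SANDWICH for reversible samplers: with ANY geometric envelope rate `ρ < 1`,
# `(1−ρ)/(1+ρ) · Var_π f ≤ σ²_f ≤ (1+ρ)/(1−ρ) · Var_π f` for every bounded observable — the envelope
# constant `A` drops out

HONEST FRAMING: exact (Metropolis-corrected) sampling algorithms for lattice gauge theory;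
figures of merit are autocorrelation/cost numbers at stated couplings and volumes; no
continuum-physics claim.

Venture `LatticeQCDFlow` (cell pub-lqcd), topic `Scoring`; FANOUT row 8 (`s0-cpn-nemc`, GEN-23).
NEW WORK of the cell, not a published result; no definition is introduced; nothing is cited as a
fact.  Setting: `κ` Markov and `π`-REVERSIBLE (`π` a probability law, hence invariant) with a geometric
sup-norm envelope `|(kop κ)^[t] g − πg| ≤ 2 C_g A ρ^t`, `0 ≤ ρ < 1` (every reversible kernel with a
Doeblin power, `Scoring/DoeblinPowerGeometricEnvelope`); `|f| ≤ C` measurable, `f̄ = f − πf`,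
`Var_π f = ∫ f̄² dπ`, `σ²_f = ∫ f̄² dπ + 2 Σ' k, ∫ f̄ (kop κ)^[k+1] f̄ dπ`.  Two inputs: (i) the even-lag
ratio theorem of `Scoring/ReversibleEvenLagRatios` at `m = 0` says `‖kop κ ḡ‖²_π ≤ ρ² ‖ḡ‖²_π` for every
centred bounded `ḡ` — FOR A REVERSIBLE KERNEL THE SUP-NORM ENVELOPE RATE IS AN `L²(π)` CONTRACTION RATE
(the constant `A` is gone); (ii) the martingale form of the variance
(`Scoring/GeometricEnvelopeBlockSumMoments.poisson_condVar_integral_eq_greenKubo_of_envelope`) with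
invariance: `σ²_f = ‖h̃‖² − ‖kop κ h̃‖²` for the centred bounded Poisson solution `h̃` (`h̃ − kop κ h̃ = f̄`).
With `a = ‖h̃‖`, `b = ‖kop κ h̃‖ ≤ ρ a`, `v = ‖f̄‖` and the triangle inequalities `|a − b| ≤ v ≤ a + b`:
`σ²_f = (a − b)(a + b)` is squeezed between `(1−ρ) a · v ≥ (1−ρ) v²/(1+ρ)` and
`v · (1+ρ) a ≤ (1+ρ) v²/(1−ρ)`.  THE SANDWICH:
**`(1−ρ)/(1+ρ) · Var_π f ≤ σ²_f ≤ (1+ρ)/(1−ρ) · Var_π f`**, i.e. `(1−ρ)/(2(1+ρ)) ≤ τ_int,f ≤ (1+ρ)/(2(1−ρ))`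
for EVERY bounded observable of EVERY reversible sampler with a certified rate `ρ` — an effective-
sample-size CEILING and FLOOR from the rate alone (the generic, non-reversible sup-norm bound
`Scoring/DoeblinAutocorrelation.tauInt_le_of_doeblin` carries `C²/Var_π f`-type constants instead).  In
particular `σ²_f > 0` quantitatively (compare `Scoring/GreenKuboDegenerateReversible`: `σ²_f = 0 ⟺ f̄ = 0`
a.e.), which settles, FOR REVERSIBLE KERNELS, the `m`-step (Doeblin POWER) positivity question left open
in row 13's `Exactness/NCMCGeneralSpaceAsymptoticVarianceLowerBound` (whose one-step floor
`σ²_f ≥ (e/(2e+4)) Var_π f` needs no reversibility): with the power's rate `ρ = 1 − e/(m+1)`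
(`Scoring/DoeblinPowerGeometricEnvelope`), `σ²_f ≥ (1−ρ)/(1+ρ) · Var_π f = e/(2m+2−e) · Var_π f`.
Printed counterparts NAMED ONLY: the spectral sandwich `(1+λ_min)/(1−λ_min) ≤ σ²/Var ≤
(1+λ_max)/(1−λ_max)` for reversible chains (Kipnis–Varadhan 1986; Geyer 1992; Sokal 1996; Rosenthal 2003)
— nothing is cited as a fact; no spectral theory is used.

## Content (`κ` `π`-reversible; envelope `(A, ρ)`, `0 ≤ ρ < 1`; `|f| ≤ C` measurable)

* **`integral_sq_kop_le_rate_sq_of_isReversible`** — `∫ (kop κ f̄)² dπ ≤ ρ² ∫ f̄² dπ` (`f̄ = f − πf`);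
* `sqrt_integral_add_sq_le_of_bounded` — Minkowski for bounded observables: `√∫(u+w)² ≤ √∫u² + √∫w²`;
* **`greenKubo_le_rate_mul_variance_of_isReversible`** — `σ²_f ≤ (1+ρ)/(1−ρ) · ∫ f̄² dπ`;
* **`rate_mul_variance_le_greenKubo_of_isReversible`** — `(1−ρ)/(1+ρ) · ∫ f̄² dπ ≤ σ²_f`;
* **`rate_mul_variance_le_greenKubo_of_nHit_of_isReversible`** — certificate form: an `m`-step Doeblin
  constant `ε` gives `(e/(m+1))/(2 − e/(m+1)) · Var_π f ≤ σ²_f` (`e = ε.toReal`);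
* **`tauInt_le_of_nHit_of_isReversible`** — certificate form of the ceiling: `τ_int(f) ≤ (m+1)/e − ½`.

NOT CLAIMED: non-reversible kernels (there the envelope rate is not an `L²` rate in general);
sharpness; unbounded observables; any `ρ` of a concrete sampler; any number of ours.
-/

noncomputable section

namespace Summit.Ventures.LatticeQCDFlow.Scoring

open MeasureTheory ProbabilityTheory Filter Finset Preorder Literature.Probability.MarkovChains
open scoped ENNReal Topology

variable {Ω : Type*} [MeasurableSpace Ω]

/-! ### Minkowski for bounded observables -/

/-- `√∫(u+w)² dμ ≤ √∫u² dμ + √∫w² dμ` for bounded measurable `u, w` and a finite measure (Cauchy–Schwarz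
`(∫ u w)² ≤ (∫u²)(∫w²)` of `Scoring/KernelTransitionOperator`). -/
theorem sqrt_integral_add_sq_le_of_bounded (μ : Measure Ω) [IsFiniteMeasure μ] {u w : Ω → ℝ}
    (hu : Measurable u) (hw : Measurable w) {Cu Cw : ℝ} (hCu : ∀ x, |u x| ≤ Cu) (hCw : ∀ x, |w x| ≤ Cw) :
    Real.sqrt (∫ x, (u x + w x) ^ 2 ∂μ) ≤ Real.sqrt (∫ x, u x ^ 2 ∂μ) + Real.sqrt (∫ x, w x ^ 2 ∂μ) := by
  set a := Real.sqrt (∫ x, u x ^ 2 ∂μ) with ha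
  set b := Real.sqrt (∫ x, w x ^ 2 ∂μ) with hb
  have hU0 : 0 ≤ ∫ x, u x ^ 2 ∂μ := integral_nonneg fun x => sq_nonneg _
  have hW0 : 0 ≤ ∫ x, w x ^ 2 ∂μ := integral_nonneg fun x => sq_nonneg _
  have hCS := sq_integral_mul_le μ hu hw hCu hCw
  have hiu : Integrable (fun x => u x ^ 2) μ :=
    integrable_of_bounded μ (hu.pow_const 2) (C := Cu ^ 2) fun x => by
      rw [abs_pow]; exact pow_le_pow_left₀ (abs_nonneg _) (hCu x) 2
  have hiw : Integrable (fun x => w x ^ 2) μ :=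
    integrable_of_bounded μ (hw.pow_const 2) (C := Cw ^ 2) fun x => by
      rw [abs_pow]; exact pow_le_pow_left₀ (abs_nonneg _) (hCw x) 2
  have hiuw : Integrable (fun x => u x * w x) μ :=
    integrable_of_bounded μ (hu.mul hw) (C := |Cu| * Cw) fun x => by
      rw [abs_mul]
      exact mul_le_mul ((hCu x).trans (le_abs_self _)) (hCw x) (abs_nonneg _) (abs_nonneg _)
  have hexp : ∫ x, (u x + w x) ^ 2 ∂μ
      = ∫ x, u x ^ 2 ∂μ + 2 * ∫ x, u x * w x ∂μ + ∫ x, w x ^ 2 ∂μ := by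
    have e : (fun x => (u x + w x) ^ 2) = fun x => (u x ^ 2 + 2 * (u x * w x)) + w x ^ 2 := by
      funext x; ring
    have hi12 : Integrable (fun x => u x ^ 2 + 2 * (u x * w x)) μ := hiu.add (hiuw.const_mul 2)
    have hi2 : Integrable (fun x => 2 * (u x * w x)) μ := hiuw.const_mul 2
    rw [e, integral_add hi12 hiw, integral_add hiu hi2, integral_const_mul]
  -- `∫ u w ≤ a b`
  have hab : ∫ x, u x * w x ∂μ ≤ a * b := by
    have h1 : (∫ x, u x * w x ∂μ) ^ 2 ≤ (a * b) ^ 2 := by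
      rw [mul_pow, ha, hb, Real.sq_sqrt hU0, Real.sq_sqrt hW0]; exact hCS
    exact (abs_le_of_sq_le_sq' h1 (mul_nonneg (Real.sqrt_nonneg _) (Real.sqrt_nonneg _))).2
  have hsum : ∫ x, (u x + w x) ^ 2 ∂μ ≤ (a + b) ^ 2 := by
    rw [hexp, add_sq, ha, hb, Real.sq_sqrt hU0, Real.sq_sqrt hW0, ← ha, ← hb]
    linarith
  calc Real.sqrt (∫ x, (u x + w x) ^ 2 ∂μ) ≤ Real.sqrt ((a + b) ^ 2) := Real.sqrt_le_sqrt hsum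
    _ = a + b := Real.sqrt_sq (add_nonneg (Real.sqrt_nonneg _) (Real.sqrt_nonneg _))

section Reversible

variable {κ : Kernel Ω Ω} [IsMarkovKernel κ] {π : Measure Ω} [IsProbabilityMeasure π] {A ρ : ℝ}

/-- **FOR A REVERSIBLE KERNEL THE ENVELOPE RATE IS AN `L²(π)` CONTRACTION RATE ON CENTRED OBSERVABLES**:
`∫ (kop κ f̄)² dπ ≤ ρ² ∫ f̄² dπ`, `f̄ = f − πf`, for every `|f| ≤ C` measurable (the even-lag ratio theorem
at `m = 0`: `C(2) = ‖kop κ f̄‖²`, `C(0) = ‖f̄‖²`). -/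
theorem integral_sq_kop_le_rate_sq_of_isReversible (hrev : Kernel.IsReversible κ π)
    (henv : ∀ (g : Ω → ℝ), Measurable g → ∀ (Cg : ℝ), (∀ x, |g x| ≤ Cg) →
      ∀ (t : ℕ) (x : Ω), |(kop κ)^[t] g x - ∫ y, g y ∂π| ≤ 2 * Cg * (A * ρ ^ t))
    {f : Ω → ℝ} (hf : Measurable f) {C : ℝ} (hC : ∀ x, |f x| ≤ C) :
    ∫ y, (kop κ (fun z => f z - ∫ u, f u ∂π) y) ^ 2 ∂π ≤ ρ ^ 2 * ∫ y, (f y - ∫ u, f u ∂π) ^ 2 ∂π := by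
  obtain ⟨hfb, hCfb, -⟩ := centred_observable_bounds π hf hC
  have h := autocov_even_succ_le_rate_sq_mul_of_isReversible hrev henv hf hC 0
  simp only [Nat.mul_zero, Nat.zero_add] at h
  have e2 : autocov κ π (fun y => f y - ∫ z, f z ∂π) 2
      = ∫ y, (kop κ (fun z => f z - ∫ u, f u ∂π) y) ^ 2 ∂π := by
    -- `C(2) = ∫ f̄ · K² f̄ = ∫ (K f̄)²` by symmetry
    have e : (kop κ)^[2] (fun z => f z - ∫ u, f u ∂π) = kop κ (kop κ (fun z => f z - ∫ u, f u ∂π)) := rfl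
    unfold autocov
    rw [e, ← integral_kop_mul_comm_of_isReversible κ hrev hfb (measurable_kop κ hfb) hCfb
      (abs_kop_le κ hCfb)]
    exact integral_congr_ae (ae_of_all _ fun y => by ring)
  have e0 : autocov κ π (fun y => f y - ∫ z, f z ∂π) 0 = ∫ y, (f y - ∫ u, f u ∂π) ^ 2 ∂π := by
    rw [autocov_zero]
  rw [e2, e0] at h
  exact h

/-- The core of the sandwich: with `a = ‖h̃‖_π`, `b = ‖kop κ h̃‖_π` for a centred bounded Poisson
solution `h̃` and `v = ‖f̄‖_π`: `σ²_f = a² − b²`, `b ≤ ρ a`, `v ≤ a + b`, `a ≤ v + b`, all nonnegative. -/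
theorem greenKubo_rate_sandwich_core_of_isReversible (hrev : Kernel.IsReversible κ π)
    (henv : ∀ (g : Ω → ℝ), Measurable g → ∀ (Cg : ℝ), (∀ x, |g x| ≤ Cg) →
      ∀ (t : ℕ) (x : Ω), |(kop κ)^[t] g x - ∫ y, g y ∂π| ≤ 2 * Cg * (A * ρ ^ t))
    (hρ0 : 0 ≤ ρ) (hρ1 : ρ < 1)
    {f : Ω → ℝ} (hf : Measurable f) {C : ℝ} (hC : ∀ x, |f x| ≤ C) :
    ∃ a b : ℝ, 0 ≤ a ∧ 0 ≤ b ∧ b ≤ ρ * a ∧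
      (∫ y, (f y - ∫ z, f z ∂π) ^ 2 ∂π)
          + 2 * ∑' k, ∫ y, (f y - ∫ z, f z ∂π) * (kop κ)^[k + 1] (fun y => f y - ∫ z, f z ∂π) y ∂π
        = a ^ 2 - b ^ 2 ∧
      Real.sqrt (∫ y, (f y - ∫ z, f z ∂π) ^ 2 ∂π) ≤ a + b ∧
      a ≤ Real.sqrt (∫ y, (f y - ∫ z, f z ∂π) ^ 2 ∂π) + b := by
  have hπ : Kernel.Invariant κ π := hrev.invariant
  obtain ⟨hfb, hCfb, -⟩ := centred_observable_bounds π hf hC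
  obtain ⟨h, hh, hCh, hpois⟩ := poisson_exists_of_geometricEnvelope henv hρ0 hρ1 hf hC
  -- centre the Poisson solution: `h̃ = h − πh` solves the same equation
  obtain ⟨hhc, hChc, -⟩ := centred_observable_bounds π hh hCh
  set m := ∫ y, h y ∂π with hm
  have hKconst : ∀ y, kop κ (fun z => h z - m) y = kop κ h y - m := fun y => by
    unfold kop
    rw [integral_sub (integrable_of_bounded _ hh hCh) (integrable_const m), integral_const,
      probReal_univ, one_smul]
  have hpois' : ∀ y, (h y - m) - kop κ (fun z => h z - m) y = f y - ∫ z, f z ∂π := fun y => by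
    rw [hKconst y, ← hpois y]; ring
  -- `σ² = ∫ h̃² − ∫ (K h̃)²`
  have hσ := greenKubo_eq_integral_sq_sub_of_envelope hπ henv hρ0 hρ1 hf hC hhc hChc hpois'
  -- the `L²` rate on the centred observable `h̃` (it is `h̃ = h − πh` of the bounded `h`)
  have hrate := integral_sq_kop_le_rate_sq_of_isReversible hrev henv hh hCh
  set a := Real.sqrt (∫ y, (h y - m) ^ 2 ∂π) with ha
  set b := Real.sqrt (∫ y, (kop κ (fun z => h z - m) y) ^ 2 ∂π) with hb
  set v := Real.sqrt (∫ y, (f y - ∫ z, f z ∂π) ^ 2 ∂π) with hv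
  have hA0 : 0 ≤ ∫ y, (h y - m) ^ 2 ∂π := integral_nonneg fun y => sq_nonneg _
  have hB0 : 0 ≤ ∫ y, (kop κ (fun z => h z - m) y) ^ 2 ∂π := integral_nonneg fun y => sq_nonneg _
  have hV0 : 0 ≤ ∫ y, (f y - ∫ z, f z ∂π) ^ 2 ∂π := integral_nonneg fun y => sq_nonneg _
  have ha2 : a ^ 2 = ∫ y, (h y - m) ^ 2 ∂π := Real.sq_sqrt hA0
  have hb2 : b ^ 2 = ∫ y, (kop κ (fun z => h z - m) y) ^ 2 ∂π := Real.sq_sqrt hB0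
  have hv2 : v ^ 2 = ∫ y, (f y - ∫ z, f z ∂π) ^ 2 ∂π := Real.sq_sqrt hV0
  have hKm : Measurable (kop κ (fun z => h z - m)) := measurable_kop κ hhc
  have hKb : ∀ y, |kop κ (fun z => h z - m) y| ≤ 2 * (4 * C * A / (1 - ρ)) := abs_kop_le κ hChc
  refine ⟨a, b, Real.sqrt_nonneg _, Real.sqrt_nonneg _, ?_, ?_, ?_, ?_⟩
  · -- `b ≤ ρ a` from `b² ≤ ρ² a²`
    have h1 : b ^ 2 ≤ (ρ * a) ^ 2 := by rw [mul_pow, ha2, hb2]; exact hrate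
    exact (abs_le_of_sq_le_sq' h1 (mul_nonneg hρ0 (Real.sqrt_nonneg _))).2
  · rw [hσ, ha2, hb2]
  · -- `v ≤ a + b`: `f̄ = h̃ + (−K h̃)`
    have hneg : ∀ y, |(-(kop κ (fun z => h z - m) y))| ≤ 2 * (4 * C * A / (1 - ρ)) := fun y => by
      rw [abs_neg]; exact hKb y
    have h1 : Real.sqrt (∫ y, ((h y - m) + (-(kop κ (fun z => h z - m) y))) ^ 2 ∂π)
        ≤ Real.sqrt (∫ y, (h y - m) ^ 2 ∂π) + Real.sqrt (∫ y, (-(kop κ (fun z => h z - m) y)) ^ 2 ∂π) :=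
      sqrt_integral_add_sq_le_of_bounded π hhc hKm.neg hChc hneg
    have e2 : ∫ y, (-(kop κ (fun z => h z - m) y)) ^ 2 ∂π = ∫ y, (kop κ (fun z => h z - m) y) ^ 2 ∂π :=
      integral_congr_ae (ae_of_all _ fun y => by ring)
    have e1 : ∫ y, (f y - ∫ z, f z ∂π) ^ 2 ∂π
        = ∫ y, ((h y - m) + (-(kop κ (fun z => h z - m) y))) ^ 2 ∂π :=
      integral_congr_ae (ae_of_all _ fun y => by
        show (f y - ∫ z, f z ∂π) ^ 2 = ((h y - m) + (-(kop κ (fun z => h z - m) y))) ^ 2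
        rw [← hpois' y]; ring)
    rw [e2, ← e1] at h1
    exact h1
  · -- `a ≤ v + b`: `h̃ = f̄ + K h̃`
    have h1 : Real.sqrt (∫ y, ((f y - ∫ z, f z ∂π) + kop κ (fun z => h z - m) y) ^ 2 ∂π)
        ≤ v + b := sqrt_integral_add_sq_le_of_bounded π hfb hKm hCfb hKb
    have e1 : ∫ y, (h y - m) ^ 2 ∂π
        = ∫ y, ((f y - ∫ z, f z ∂π) + kop κ (fun z => h z - m) y) ^ 2 ∂π :=
      integral_congr_ae (ae_of_all _ fun y => by
        show (h y - m) ^ 2 = ((f y - ∫ z, f z ∂π) + kop κ (fun z => h z - m) y) ^ 2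
        rw [← hpois' y]; ring)
    rw [ha, e1]
    exact h1

/-- **UPPER HALF OF THE SANDWICH**: `σ²_f ≤ (1+ρ)/(1−ρ) · Var_π f` for a `π`-reversible kernel with the
envelope (`0 ≤ ρ < 1`) and every `|f| ≤ C` measurable. -/
theorem greenKubo_le_rate_mul_variance_of_isReversible (hrev : Kernel.IsReversible κ π)
    (henv : ∀ (g : Ω → ℝ), Measurable g → ∀ (Cg : ℝ), (∀ x, |g x| ≤ Cg) →
      ∀ (t : ℕ) (x : Ω), |(kop κ)^[t] g x - ∫ y, g y ∂π| ≤ 2 * Cg * (A * ρ ^ t))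
    (hρ0 : 0 ≤ ρ) (hρ1 : ρ < 1)
    {f : Ω → ℝ} (hf : Measurable f) {C : ℝ} (hC : ∀ x, |f x| ≤ C) :
    (∫ y, (f y - ∫ z, f z ∂π) ^ 2 ∂π)
        + 2 * ∑' k, ∫ y, (f y - ∫ z, f z ∂π) * (kop κ)^[k + 1] (fun y => f y - ∫ z, f z ∂π) y ∂π
      ≤ (1 + ρ) / (1 - ρ) * ∫ y, (f y - ∫ z, f z ∂π) ^ 2 ∂π := by
  obtain ⟨a, b, ha0, hb0, hba, hσ, hv1, hv2⟩ :=
    greenKubo_rate_sandwich_core_of_isReversible hrev henv hρ0 hρ1 hf hC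
  set v := Real.sqrt (∫ y, (f y - ∫ z, f z ∂π) ^ 2 ∂π) with hv
  have hV0 : 0 ≤ ∫ y, (f y - ∫ z, f z ∂π) ^ 2 ∂π := integral_nonneg fun y => sq_nonneg _
  have hvsq : v ^ 2 = ∫ y, (f y - ∫ z, f z ∂π) ^ 2 ∂π := Real.sq_sqrt hV0
  have hv0 : 0 ≤ v := Real.sqrt_nonneg _
  have h1ρ : 0 < 1 - ρ := sub_pos.2 hρ1
  rw [hσ, ← hvsq, div_mul_eq_mul_div, le_div_iff₀ h1ρ]
  -- `a (1−ρ) ≤ v`, `a − b ≤ v`, `a + b ≤ (1+ρ) a`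
  have ha_le : a * (1 - ρ) ≤ v := by nlinarith
  have hab : a - b ≤ v := by linarith
  have hapb : a + b ≤ (1 + ρ) * a := by linarith
  have key1 : (a - b) * (a + b) ≤ v * ((1 + ρ) * a) := mul_le_mul hab hapb (by linarith) hv0
  have key2 : v * ((1 + ρ) * a) * (1 - ρ) ≤ (1 + ρ) * v ^ 2 := by
    have h := mul_le_mul_of_nonneg_left ha_le (mul_nonneg hv0 (by linarith : (0 : ℝ) ≤ 1 + ρ))
    have e1 : v * ((1 + ρ) * a) * (1 - ρ) = v * (1 + ρ) * (a * (1 - ρ)) := by ring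
    have e2 : (1 + ρ) * v ^ 2 = v * (1 + ρ) * v := by ring
    rw [e1, e2]; exact h
  have key3 := mul_le_mul_of_nonneg_right key1 h1ρ.le
  have e : (a ^ 2 - b ^ 2) * (1 - ρ) = (a - b) * (a + b) * (1 - ρ) := by ring
  rw [e]
  linarith

/-- **LOWER HALF OF THE SANDWICH**: `(1−ρ)/(1+ρ) · Var_π f ≤ σ²_f`. -/
theorem rate_mul_variance_le_greenKubo_of_isReversible (hrev : Kernel.IsReversible κ π)
    (henv : ∀ (g : Ω → ℝ), Measurable g → ∀ (Cg : ℝ), (∀ x, |g x| ≤ Cg) →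
      ∀ (t : ℕ) (x : Ω), |(kop κ)^[t] g x - ∫ y, g y ∂π| ≤ 2 * Cg * (A * ρ ^ t))
    (hρ0 : 0 ≤ ρ) (hρ1 : ρ < 1)
    {f : Ω → ℝ} (hf : Measurable f) {C : ℝ} (hC : ∀ x, |f x| ≤ C) :
    (1 - ρ) / (1 + ρ) * ∫ y, (f y - ∫ z, f z ∂π) ^ 2 ∂π
      ≤ (∫ y, (f y - ∫ z, f z ∂π) ^ 2 ∂π)
        + 2 * ∑' k, ∫ y, (f y - ∫ z, f z ∂π) * (kop κ)^[k + 1] (fun y => f y - ∫ z, f z ∂π) y ∂π := by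
  obtain ⟨a, b, ha0, hb0, hba, hσ, hv1, hv2⟩ :=
    greenKubo_rate_sandwich_core_of_isReversible hrev henv hρ0 hρ1 hf hC
  set v := Real.sqrt (∫ y, (f y - ∫ z, f z ∂π) ^ 2 ∂π) with hv
  have hV0 : 0 ≤ ∫ y, (f y - ∫ z, f z ∂π) ^ 2 ∂π := integral_nonneg fun y => sq_nonneg _
  have hvsq : v ^ 2 = ∫ y, (f y - ∫ z, f z ∂π) ^ 2 ∂π := Real.sq_sqrt hV0
  have hv0 : 0 ≤ v := Real.sqrt_nonneg _
  have h1ρ : 0 < 1 + ρ := by linarith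
  rw [hσ, ← hvsq, div_mul_eq_mul_div, div_le_iff₀ h1ρ]
  -- `(1−ρ) a ≤ a − b`, `v ≤ a + b`, `v ≤ (1+ρ) a`
  have h1 : (1 - ρ) * a ≤ a - b := by nlinarith
  have h2 : v ≤ (1 + ρ) * a := by nlinarith
  have h1ρ' : 0 ≤ 1 - ρ := sub_nonneg.2 hρ1.le
  have key : ((1 - ρ) * a) * v ≤ (a - b) * (a + b) :=
    mul_le_mul h1 hv1 hv0 (by nlinarith)
  have k2 : (1 - ρ) * v * v ≤ (1 - ρ) * v * ((1 + ρ) * a) :=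
    mul_le_mul_of_nonneg_left h2 (mul_nonneg h1ρ' hv0)
  have k3 := mul_le_mul_of_nonneg_left key h1ρ.le
  have e1 : (1 - ρ) * v ^ 2 = (1 - ρ) * v * v := by ring
  have e2 : (1 - ρ) * v * ((1 + ρ) * a) = (1 + ρ) * ((1 - ρ) * a * v) := by ring
  have e3 : (a ^ 2 - b ^ 2) * (1 + ρ) = (1 + ρ) * ((a - b) * (a + b)) := by ring
  rw [e1, e3]
  linarith

/-- **THE `m`-STEP POSITIVITY FLOOR FOR REVERSIBLE KERNELS, IN CERTIFICATE FORM**: `κ` `π`-reversible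
(`π` a probability law) with an `m`-step Doeblin certificate `(nHit κ m)(x, ·) ≥ ε ν` (`0 < ε ≤ 1`,
`0 < m`, `e = ε.toReal`); then for every `|f| ≤ C` measurable
`(e/(m+1))/(2 − e/(m+1)) · Var_π f ≤ σ²_f` — the Doeblin-POWER analogue, for reversible kernels, of row 13's
one-step floor. -/
theorem rate_mul_variance_le_greenKubo_of_nHit_of_isReversible (hrev : Kernel.IsReversible κ π)
    {m : ℕ} {ε : ℝ≥0∞} {ν : Measure Ω} [IsProbabilityMeasure ν]
    (hmin : ∀ x {B : Set Ω}, MeasurableSet B → ε * ν B ≤ Exactness.nHit κ m x B)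
    (hε0 : 0 < ε) (hε1 : ε ≤ 1) (hm : 0 < m)
    {f : Ω → ℝ} (hf : Measurable f) {C : ℝ} (hC : ∀ x, |f x| ≤ C) :
    (ε.toReal / ((m : ℝ) + 1)) / (2 - ε.toReal / ((m : ℝ) + 1)) * ∫ y, (f y - ∫ z, f z ∂π) ^ 2 ∂π
      ≤ (∫ y, (f y - ∫ z, f z ∂π) ^ 2 ∂π)
        + 2 * ∑' k, ∫ y, (f y - ∫ z, f z ∂π) * (kop κ)^[k + 1] (fun y => f y - ∫ z, f z ∂π) y ∂π := by
  have hπ : Kernel.Invariant κ π := hrev.invariant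
  have hεtop : ε ≠ ∞ := ne_top_of_le_ne_top ENNReal.one_ne_top hε1
  have he0 : 0 < ε.toReal := ENNReal.toReal_pos hε0.ne' hεtop
  have he1 : ε.toReal ≤ 1 := ENNReal.toReal_le_of_le_ofReal zero_le_one (by simpa using hε1)
  set ρ : ℝ := 1 - ε.toReal / ((m : ℝ) + 1) with hρ
  have hρ0 : 0 < ρ := doeblinPower_rate_pos he1 hm
  have hρ1 : ρ < 1 := doeblinPower_rate_lt_one he0 m
  have henv : ∀ (g : Ω → ℝ), Measurable g → ∀ (Cg : ℝ), (∀ x, |g x| ≤ Cg) →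
      ∀ (t : ℕ) (x : Ω), |(kop κ)^[t] g x - ∫ y, g y ∂π| ≤ 2 * Cg * ((ρ ^ m)⁻¹ * ρ ^ t) :=
    fun g hg Cg hCg t x => geometricEnvelope_of_nHit hmin hε1 hm hπ hg hCg t x
  have h := rate_mul_variance_le_greenKubo_of_isReversible hrev henv hρ0.le hρ1 hf hC
  have e : (1 - ρ) / (1 + ρ) = (ε.toReal / ((m : ℝ) + 1)) / (2 - ε.toReal / ((m : ℝ) + 1)) := by
    rw [hρ]; congr 1 <;> ring
  rw [e] at h
  exact h

/-- **THE `τ_int` CEILING IN CERTIFICATE FORM**: `κ` `π`-reversible with an `m`-step Doeblin certificate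
`(nHit κ m)(x, ·) ≥ ε ν` (`0 < ε ≤ 1`, `0 < m`, `e = ε.toReal`) and `|f| ≤ C` measurable with `Var_π f ≠ 0`:
`τ_int(f) ≤ (m + 1)/e − ½` (the rate `ρ = 1 − e/(m+1)` in `Scoring/ReversibleEvenLagRatios.tauInt_le_rate_of_isReversible`;
compare `Scoring/DoeblinAutocorrelation.tauInt_le_of_doeblin`: `1/e − ½` for a ONE-step minorisation by
`π` itself, any kernel). -/
theorem tauInt_le_of_nHit_of_isReversible (hrev : Kernel.IsReversible κ π)
    {m : ℕ} {ε : ℝ≥0∞} {ν : Measure Ω} [IsProbabilityMeasure ν]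
    (hmin : ∀ x {B : Set Ω}, MeasurableSet B → ε * ν B ≤ Exactness.nHit κ m x B)
    (hε0 : 0 < ε) (hε1 : ε ≤ 1) (hm : 0 < m)
    {f : Ω → ℝ} (hf : Measurable f) {C : ℝ} (hC : ∀ x, |f x| ≤ C)
    (hvar : autocov κ π (fun y => f y - ∫ z, f z ∂π) 0 ≠ 0) :
    tauInt (fun t => autocov κ π (fun y => f y - ∫ z, f z ∂π) t
        / autocov κ π (fun y => f y - ∫ z, f z ∂π) 0) ≤ ((m : ℝ) + 1) / ε.toReal - 1 / 2 := by
  have hπ : Kernel.Invariant κ π := hrev.invariant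
  have hεtop : ε ≠ ∞ := ne_top_of_le_ne_top ENNReal.one_ne_top hε1
  have he0 : 0 < ε.toReal := ENNReal.toReal_pos hε0.ne' hεtop
  have he1 : ε.toReal ≤ 1 := ENNReal.toReal_le_of_le_ofReal zero_le_one (by simpa using hε1)
  set ρ : ℝ := 1 - ε.toReal / ((m : ℝ) + 1) with hρ
  have hρ0 : 0 < ρ := doeblinPower_rate_pos he1 hm
  have hρ1 : ρ < 1 := doeblinPower_rate_lt_one he0 m
  have henv : ∀ (g : Ω → ℝ), Measurable g → ∀ (Cg : ℝ), (∀ x, |g x| ≤ Cg) →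
      ∀ (t : ℕ) (x : Ω), |(kop κ)^[t] g x - ∫ y, g y ∂π| ≤ 2 * Cg * ((ρ ^ m)⁻¹ * ρ ^ t) :=
    fun g hg Cg hCg t x => geometricEnvelope_of_nHit hmin hε1 hm hπ hg hCg t x
  have h := tauInt_le_rate_of_isReversible hrev henv hρ0.le hρ1 hf hC hvar
  have e : (1 + ρ) / (2 * (1 - ρ)) = ((m : ℝ) + 1) / ε.toReal - 1 / 2 := by
    have e1 : 1 - ρ = ε.toReal / ((m : ℝ) + 1) := by rw [hρ]; ring
    have e2 : 1 + ρ = 2 - ε.toReal / ((m : ℝ) + 1) := by rw [hρ]; ring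
    rw [e1, e2, div_eq_iff (by positivity)]
    field_simp
  rw [e] at h
  exact h

end Reversible

end Summit.Ventures.LatticeQCDFlow.Scoring

end
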